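/-
Copyright (c) 2026 the pub-hodgecm-mathlib formalisation cell (harness21).  Prover seat hodgecm-mathlib-K2E2-p12 (g6): Track B «K2-LIT», ENGINE E1,
h413 = stmt-HodgeConjecture-24833; line `K2_E1_TraceFormulaBeta`, 5Res campaign «ENDGAME BY FAMILIES», ROADCARD §3′ (M2 v2, amendment #2), deal of K2E1-plan (g7) 13:2xZ:
GELFAND'S TRICK — the `χ`-spherical Hecke algebra is COMMUTATIVE when an anti-automorphism `θ` makes every `g` `K`-conjugate to `θ g` (U(1,1): `gᵀ = k g k⁻¹`).
-/
import Summits.HodgeConjecture.HodgeConjecture.Theorems.K2E1KTypeProjectorPureTensorU   -- ★ p860372 (+ ★ p860333, ★ `IntegratedOperatorStar`: `mulConv`, `integratedOperator_comp_integratedOperator`, `exists_compactlySupported_mulConv`)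
import HarnessLib

/-!
# K2·E1 — `K2E1TauSphericalHeckeCommutativeU11`: GELFAND'S TRICK — IF AN ANTI-AUTOMORPHISM `θ` OF `G` PRESERVES HAAR MEASURE AND `θ g` IS `K`-CONJUGATE TO `g` FOR EVERY `g`
# (U(1,1): `θ = transpose`, `gᵀ = k g k⁻¹`, ★ p859876), THEN THE `χ`-SPHERICAL HECKE ALGEBRA (`χ` A CHARACTER OF `K`) IS COMMUTATIVE: `f₁ ⋆ f₂ = f₂ ⋆ f₁`, `R(f₁)R(f₂) = R(f₂)R(f₁)`
# [Helgason GGA IV §3 Thm 3.1; Lang SL₂(ℝ) IV §1; Knapp 1986 VIII §3; Deitmar–Echterhoff Prop. 6.2.1]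

Track B ∕ K2-LIT, crux h413 = `stmt-HodgeConjecture-24833`, route of record `HCCMUnconditional`; cell `hodgecm-mathlib`, squad K2, ENGINE E1 (5Res campaign, M2 v2 §3′.1: the arch letter
`hcommTau` hidden in `hTB` of ★ p860278 ∕ ★ D5′ p860349 — «the `(τ,τ)`-spherical Hecke algebra of `G_∞ = U(1,1)` is commutative»).  THEOREMS ONLY (no `def`, no `instance`, no notation, no
named-fact hypothesis, no `sorry`; default heartbeats); lane `--supports stmt-HodgeConjecture-24833 --as helper` (count-neutral).  CLOSES NO SOCKET.

SETTING (generic, hypothesis-first — §1): a topological group `G` with a measure `η` (left-invariant and inversion-invariant: a Haar measure of a unimodular group), a homeomorphism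
`θ : G ≃ₜ G` that is an ANTI-automorphism (`hθmul : θ (x * y) = θ y * θ x`) and MEASURE-PRESERVING (`hθη : MeasurePreserving θ η η`); a «compact» `K` entering only through
`κ : K →* G` and a multiplicative `χ : K → ℂ` with `χ 1 = 1` (E1: `χ = conj τ`, `τ` a character of the abelian `K_∞ = U(1) × U(1)`); `f` is `χ`-SPHERICAL when `f (κ k * x) = χ k * f x` and
`f (x * κ k) = χ k * f x` (the shapes of ★ p860372 `hh_of_spherical`).  THE STRUCTURAL LETTER: `hconj : ∀ g, ∃ k, θ g = κ k * g * (κ k)⁻¹` — for `U(1,1)` with `θ = ᵀ` this is ★ p859876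
`exists_kV_conj_eq_transpose_one_one` (`|b| = |c|` for `g = [[a,b],[c,d]] ∈ U(1,1)`; frame-independent, the frame change being real orthogonal); no `KAK` decomposition is needed.
* §1.1 `theta_one`, `theta_inv` (anti-automorphisms fix `1` and commute with inversion); **`comp_theta_eq_of_spherical`** — `χ`-spherical `f` is `θ`-invariant under `hconj`
  (`f(kgk⁻¹) = χ(k) f(g) χ(k⁻¹) = f(g)`); the `KAK` variant **`comp_theta_eq_of_KAK`** (`θ` fixes `κ(K)` and a set of representatives pointwise).
* §1.2 **`mulConv_spherical_left ∕ _right`** — `f₁ ⋆ f₂` is again `χ`-spherical (`η` left-invariant for the left law).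
* §1.3 **`mulConv_theta` (GELFAND)** — for `θ`-invariant `f₁, f₂`: `(f₁ ⋆ f₂)(θ x) = (f₂ ⋆ f₁)(x)` (substitutions `u ↦ θ u`, then `y = x u⁻¹`, unimodularity); **`mulConv_comm_of_theta`** — if moreover
  `f₂ ⋆ f₁` is `θ`-invariant then `f₁ ⋆ f₂ = f₂ ⋆ f₁`; **`mulConv_comm_of_spherical`** — `χ`-spherical `f₁, f₂` commute under `hconj`.
* §1.4 THE OPERATOR PRINT **`integratedOperator_comm_of_spherical`** — for every unitary strongly continuous `σ` of `G` (E1: `σ = π|_{G_∞} = π.restrict archToAdelic`, so this IS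
  `R₁ f₁ ∘L R₁ f₂ = R₁ f₂ ∘L R₁ f₁`): `σ(f₁) ∘ σ(f₂) = σ(f₂) ∘ σ(f₁)` for `χ`-spherical `f₁, f₂ ∈ C_c(G)` (★ `integratedOperator_comp_integratedOperator`).
The E1 discharge of `θ` (entrywise transpose on `arch ≤ GL₂(mixedSpace L)`, an anti-automorphic homeomorphism preserving `arch` for `J₂ = antidiag(1,1)`) and of `hconj` (the frame transport
`arch ≅ ∏_w U(1,1)` + ★ p859876) is the separate arch-frame file; here both stay letters.
HONEST LABEL: HC_CM is proved only modulo the 7 printed citations (2 remaining named inputs: hLiu418 = `stmt-HodgeConjecture-24832`, h413 = `stmt-HodgeConjecture-24833`) until rung 0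
closes; this file asserts no named fact and closes no socket; count-neutral; unconditional.

## References
* [Helgason2000] S. Helgason, *Groups and Geometric Analysis* (AMS 2000; orig. 1984): Ch. IV §3, Thm. 3.1 and its proof (Gelfand's trick with an anti-automorphism); cf. S. Lang, *SL₂(ℝ)*, Ch. IV §1, Thm. 1 (`g ↦ ᵗg`).
* [Knapp1986] A. W. Knapp, *Representation Theory of Semisimple Groups* (1986): VIII §3.
* [DeitmarEchterhoff2014] A. Deitmar, S. Echterhoff, *Principles of Harmonic Analysis* (2nd ed., 2014): Prop. 6.2.1, Lemma 1.6.3.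
-/

set_option autoImplicit false
set_option linter.dupNamespace false -- the mandated namespace repeats `HodgeConjecture.HodgeConjecture`

noncomputable section

open MeasureTheory Filter Topology CompactlySupported
open Literature.NumberTheory.Automorphic

namespace Summit.HodgeConjecture.HodgeConjecture.Cruxes.H413.K2E1TauSphericalHeckeCommutativeU11

section Generic

variable {G K : Type*} [Group G] [TopologicalSpace G] [Group K]
  (θ : G ≃ₜ G) (hθmul : ∀ x y : G, θ (x * y) = θ y * θ x) (κ : K →* G) (χ : K → ℂ)

/-! ### §1.1 Anti-automorphisms and the `θ`-invariance of `χ`-spherical functions -/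

include hθmul in
/-- An anti-automorphism fixes `1`. [folklore] -/
theorem theta_one : θ 1 = 1 := by
  have h := hθmul 1 1
  rw [mul_one] at h
  exact mul_eq_left.mp h.symm

include hθmul in
/-- An anti-automorphism commutes with inversion: `θ (x⁻¹) = (θ x)⁻¹`. [folklore] -/
theorem theta_inv (x : G) : θ x⁻¹ = (θ x)⁻¹ := by
  have h : θ x * θ x⁻¹ = 1 := by rw [← hθmul, inv_mul_cancel, theta_one θ hθmul]
  exact (eq_inv_of_mul_eq_one_right h)

/-- **A `χ`-SPHERICAL FUNCTION IS `θ`-INVARIANT** when every `θ g` is `K`-conjugate to `g` (`hconj`; U(1,1): `gᵀ = k g k⁻¹`, ★ p859876) and `χ` is multiplicative with `χ 1 = 1`: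
`f (k g k⁻¹) = χ(k) · f(g) · χ(k⁻¹) = f(g)`. [cite: Helgason2000, Ch. IV §3 Thm. 3.1] -/
theorem comp_theta_eq_of_spherical (hχmul : ∀ k l, χ (k * l) = χ k * χ l) (hχone : χ 1 = 1) (hconj : ∀ g : G, ∃ k : K, θ g = κ k * g * (κ k)⁻¹)
    (f : G → ℂ) (hleft : ∀ (k : K) (x : G), f (κ k * x) = χ k * f x) (hright : ∀ (k : K) (x : G), f (x * κ k) = χ k * f x) (g : G) :
    f (θ g) = f g := by
  obtain ⟨k, hk⟩ := hconj g
  rw [hk, mul_assoc, hleft, ← map_inv, hright, ← mul_assoc, ← hχmul, mul_inv_cancel, hχone, one_mul]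

include hθmul in
/-- **THE `KAK` VARIANT**: if `θ` fixes `κ(K)` pointwise and every `g` is `κ k₁ · s · κ k₂` with `θ s = s`, then every `χ`-spherical `f` is `θ`-invariant (`f(θ g) = f(k₂ s k₁) = χ(k₂)f(s)χ(k₁)`).
[cite: Helgason2000, Ch. IV §3 Thm. 3.1] -/
theorem comp_theta_eq_of_KAK (hθK : ∀ k : K, θ (κ k) = κ k) (hKAK : ∀ g : G, ∃ (k₁ k₂ : K) (s : G), θ s = s ∧ g = κ k₁ * s * κ k₂)
    (f : G → ℂ) (hleft : ∀ (k : K) (x : G), f (κ k * x) = χ k * f x) (hright : ∀ (k : K) (x : G), f (x * κ k) = χ k * f x) (g : G) :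
    f (θ g) = f g := by
  obtain ⟨k₁, k₂, s, hs, rfl⟩ := hKAK g
  rw [hθmul, hθmul, hθK, hθK, hs, hleft, hright, mul_assoc (κ k₁), hleft, hright, mul_left_comm]

/-! ### §1.2 Convolutions of `χ`-spherical functions are `χ`-spherical -/

variable [MeasurableSpace G] (η : Measure G)

omit [TopologicalSpace G] in
/-- **`f₁ ⋆ f₂` IS LEFT `χ`-SPHERICAL** when `f₁` is (`η` left-invariant; substitution `u = κ k · v`). [cite: Knapp1986, VIII §3] -/
theorem mulConv_spherical_left [MeasurableMul G] [η.IsMulLeftInvariant] (f₁ f₂ : G → ℂ) (hleft : ∀ (k : K) (x : G), f₁ (κ k * x) = χ k * f₁ x) (k : K) (x : G) :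
    mulConv η f₁ f₂ (κ k * x) = χ k * mulConv η f₁ f₂ x := by
  rw [mulConv_apply, mulConv_apply, ← integral_const_mul, ← integral_mul_left_eq_self _ (κ k)]
  refine integral_congr_ae (Eventually.of_forall fun v => ?_)
  change f₁ (κ k * v) * f₂ ((κ k * v)⁻¹ * (κ k * x)) = χ k * (f₁ v * f₂ (v⁻¹ * x))
  rw [hleft, mul_inv_rev, mul_assoc (v⁻¹), inv_mul_cancel_left, mul_assoc]

omit [TopologicalSpace G] in
/-- **`f₁ ⋆ f₂` IS RIGHT `χ`-SPHERICAL** when `f₂` is (no measure hypothesis). [cite: Knapp1986, VIII §3] -/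
theorem mulConv_spherical_right (f₁ f₂ : G → ℂ) (hright : ∀ (k : K) (x : G), f₂ (x * κ k) = χ k * f₂ x) (k : K) (x : G) :
    mulConv η f₁ f₂ (x * κ k) = χ k * mulConv η f₁ f₂ x := by
  rw [mulConv_apply, mulConv_apply, ← integral_const_mul]
  refine integral_congr_ae (Eventually.of_forall fun u => ?_)
  change f₁ u * f₂ (u⁻¹ * (x * κ k)) = χ k * (f₁ u * f₂ (u⁻¹ * x))
  rw [← mul_assoc, hright, mul_left_comm]

/-! ### §1.3 Gelfand's trick -/

include hθmul in
/-- **GELFAND'S COMPUTATION**: for an anti-automorphic, measure-preserving `θ` and `θ`-invariant `f₁, f₂` on a unimodular group, `(f₁ ⋆ f₂)(θ x) = (f₂ ⋆ f₁)(x)`: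
`∫ f₁(u) f₂(u⁻¹ θx) du = ∫ f₁(θu) f₂(θ(x u⁻¹)) du = ∫ f₁(u) f₂(x u⁻¹) du = ∫ f₂(y) f₁(y⁻¹ x) dy` (`y = x u⁻¹`, left- and inversion-invariance). [cite: Helgason2000, Ch. IV §3 Thm. 3.1]
-/
theorem mulConv_theta [BorelSpace G] [IsTopologicalGroup G] [MeasurableMul G] [MeasurableInv G] [η.IsMulLeftInvariant] [η.IsInvInvariant] (hθη : MeasurePreserving θ η η)
    (f₁ f₂ : G → ℂ) (hf₁ : ∀ x, f₁ (θ x) = f₁ x) (hf₂ : ∀ x, f₂ (θ x) = f₂ x) (x : G) :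
    mulConv η f₁ f₂ (θ x) = mulConv η f₂ f₁ x := by
  rw [mulConv_apply, mulConv_apply]
  -- substitute `u ↦ θ u`
  rw [← hθη.integral_comp θ.measurableEmbedding (fun u => f₁ u * f₂ (u⁻¹ * θ x))]
  have h1 : (fun u => f₁ (θ u) * f₂ ((θ u)⁻¹ * θ x)) = fun u => f₁ u * f₂ (x * u⁻¹) := by
    funext u
    rw [hf₁, ← theta_inv θ hθmul, ← hθmul, hf₂]
  rw [h1]
  -- substitute `y = x u⁻¹` on the right: `∫ F y = ∫ F (x v) = ∫ F (x u⁻¹)`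
  symm
  rw [← integral_mul_left_eq_self _ x, ← integral_inv_eq_self (fun v => f₂ (x * v) * f₁ ((x * v)⁻¹ * x)) η]
  refine integral_congr_ae (Eventually.of_forall fun u => ?_)
  change f₂ (x * u⁻¹) * f₁ ((x * u⁻¹)⁻¹ * x) = f₁ u * f₂ (x * u⁻¹)
  rw [mul_inv_rev, inv_inv, mul_assoc, inv_mul_cancel, mul_one, mul_comm]

include hθmul in
/-- **GELFAND'S TRICK**: if `f₁`, `f₂` and `f₂ ⋆ f₁` are `θ`-invariant then `f₁ ⋆ f₂ = f₂ ⋆ f₁`. [cite: Helgason2000, Ch. IV §3 Thm. 3.1] -/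
theorem mulConv_comm_of_theta [BorelSpace G] [IsTopologicalGroup G] [MeasurableMul G] [MeasurableInv G] [η.IsMulLeftInvariant] [η.IsInvInvariant] (hθη : MeasurePreserving θ η η)
    (f₁ f₂ : G → ℂ) (hf₁ : ∀ x, f₁ (θ x) = f₁ x) (hf₂ : ∀ x, f₂ (θ x) = f₂ x) (h₂₁ : ∀ x, mulConv η f₂ f₁ (θ x) = mulConv η f₂ f₁ x) :
    mulConv η f₁ f₂ = mulConv η f₂ f₁ := by
  funext x
  have h := mulConv_theta θ hθmul η hθη f₁ f₂ hf₁ hf₂ (θ.symm x)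
  rw [Homeomorph.apply_symm_apply] at h
  rw [h, ← h₂₁ (θ.symm x), Homeomorph.apply_symm_apply]

include hθmul in
/-- **THE `χ`-SPHERICAL HECKE ALGEBRA IS COMMUTATIVE** under the structural letter `hconj` (every `θ g` is `K`-conjugate to `g`): `f₁ ⋆ f₂ = f₂ ⋆ f₁` for `χ`-spherical `f₁, f₂`
(`f₂ ⋆ f₁` is `χ`-spherical by §1.2, hence `θ`-invariant by §1.1).  U(1,1), `K = U(1) × U(1)`, `θ = ᵀ`: the `(τ,τ)`-spherical algebra of every character `τ` is commutative.
[cite: Helgason2000, Ch. IV §3 Thm. 3.1] [cite: Knapp1986, VIII §3] -/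
theorem mulConv_comm_of_spherical [BorelSpace G] [IsTopologicalGroup G] [MeasurableMul G] [MeasurableInv G] [η.IsMulLeftInvariant] [η.IsInvInvariant] (hθη : MeasurePreserving θ η η)
    (hχmul : ∀ k l, χ (k * l) = χ k * χ l) (hχone : χ 1 = 1) (hconj : ∀ g : G, ∃ k : K, θ g = κ k * g * (κ k)⁻¹)
    (f₁ f₂ : G → ℂ) (h₁l : ∀ (k : K) (x : G), f₁ (κ k * x) = χ k * f₁ x) (h₁r : ∀ (k : K) (x : G), f₁ (x * κ k) = χ k * f₁ x)
    (h₂l : ∀ (k : K) (x : G), f₂ (κ k * x) = χ k * f₂ x) (h₂r : ∀ (k : K) (x : G), f₂ (x * κ k) = χ k * f₂ x) :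
    mulConv η f₁ f₂ = mulConv η f₂ f₁ :=
  mulConv_comm_of_theta θ hθmul η hθη f₁ f₂ (comp_theta_eq_of_spherical θ κ χ hχmul hχone hconj f₁ h₁l h₁r) (comp_theta_eq_of_spherical θ κ χ hχmul hχone hconj f₂ h₂l h₂r)
    (comp_theta_eq_of_spherical θ κ χ hχmul hχone hconj _ (mulConv_spherical_left κ χ η f₂ f₁ h₂l) (mulConv_spherical_right κ χ η f₂ f₁ h₁r))

/-! ### §1.4 The operator print -/

include hθmul in
/-- **THE OPERATOR PRINT: `σ(f₁) ∘ σ(f₂) = σ(f₂) ∘ σ(f₁)` FOR `χ`-SPHERICAL `f₁, f₂ ∈ C_c(G)`** and every unitary strongly continuous representation `σ` of `G` (E1: `σ = π|_{G_∞} =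
π.restrict archToAdelic`, so this is `R₁ f₁ ∘L R₁ f₂ = R₁ f₂ ∘L R₁ f₁` — the letter `hcommTau` of the D-road): `σ(f₁)σ(f₂) = σ(f₁ ⋆ f₂) = σ(f₂ ⋆ f₁) = σ(f₂)σ(f₁)`
(★ `integratedOperator_comp_integratedOperator`, §1.3). [cite: DeitmarEchterhoff2014, Prop. 6.2.1] -/
theorem integratedOperator_comm_of_spherical [BorelSpace G] [IsTopologicalGroup G] [LocallyCompactSpace G] [SecondCountableTopology G]
    [IsFiniteMeasureOnCompacts η] [SFinite η] [η.IsMulLeftInvariant] [η.IsInvInvariant] (hθη : MeasurePreserving θ η η)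
    (hχmul : ∀ k l, χ (k * l) = χ k * χ l) (hχone : χ 1 = 1) (hconj : ∀ g : G, ∃ k : K, θ g = κ k * g * (κ k)⁻¹)
    {V : Type*} [NormedAddCommGroup V] [InnerProductSpace ℂ V] [CompleteSpace V] (σ : ContRepresentation ℂ G V) (hu : σ.IsUnitary) (hc : σ.IsStronglyContinuous)
    (f₁ f₂ : C_c(G, ℂ)) (h₁l : ∀ (k : K) (x : G), f₁ (κ k * x) = χ k * f₁ x) (h₁r : ∀ (k : K) (x : G), f₁ (x * κ k) = χ k * f₁ x)
    (h₂l : ∀ (k : K) (x : G), f₂ (κ k * x) = χ k * f₂ x) (h₂r : ∀ (k : K) (x : G), f₂ (x * κ k) = χ k * f₂ x) :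
    σ.integratedOperator hu hc η f₁ ∘L σ.integratedOperator hu hc η f₂ = σ.integratedOperator hu hc η f₂ ∘L σ.integratedOperator hu hc η f₁ := by
  obtain ⟨F₁₂, hF₁₂⟩ := exists_compactlySupported_mulConv η f₁ f₂
  obtain ⟨F₂₁, hF₂₁⟩ := exists_compactlySupported_mulConv η f₂ f₁
  have hcomm := mulConv_comm_of_spherical θ hθmul κ χ η hθη hχmul hχone hconj (⇑f₁) (⇑f₂) h₁l h₁r h₂l h₂r
  have hF : F₁₂ = F₂₁ := by
    ext x
    rw [hF₁₂, hF₂₁, hcomm]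
  rw [ContRepresentation.integratedOperator_comp_integratedOperator hu hc η f₁ f₂ F₁₂ hF₁₂,
    ContRepresentation.integratedOperator_comp_integratedOperator hu hc η f₂ f₁ F₂₁ hF₂₁, hF]

end Generic

end Summit.HodgeConjecture.HodgeConjecture.Cruxes.H413.K2E1TauSphericalHeckeCommutativeU11

end
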